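import Mathlib
import Summits.Ventures.HodgeRepro2.T7SupportIntegratedForm
import Summits.Ventures.HodgeRepro2.Tier7.Line3.SchurProjector
import Summits.Ventures.HodgeRepro2.Tier7.Line3.CompactUnimodular

/-!
# Tier7/Line3/OneVectorProjector — the integrated one-vector coefficient is an orthogonal projection on every
unitary representation of the compact group, and its range lies in embedded copies of `τ` (seat t7-L1-p2, gen 3)

LINE 3 (t7-plan-3), version (ii), memo v13 §2g property (2): at the compact place the line's test function is
`f(g) = d_τ · ⟪τ g u, u⟫` (`τ` the finite-dimensional irreducible unitary representation of the compact group
`U(W_A)(F_{ι₁})`, `‖u‖ = 1`), and «by Schur orthogonality `R(f)` is the orthogonal projection onto the `u`-line in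
each copy of `τ` and kills every `σ ≇ τ`». p4's `SchurProjector` (p676191) proves this on ONE finite-dimensional
irreducible and leaves «the passage from the single irreducible to each copy of `τ` in `L²([G])`» to the printed
isotypic decomposition. THIS FILE proves the whole-space statement in the kernel, for EVERY unitary representation
`π` of the compact group `G` on a Hilbert space `H` that is strongly continuous (`∀ x, Continuous (g ↦ π g x)` —
what every unitary representation on a Hilbert space satisfies, `L²([G])` with the right regular action included;
no operator-norm continuity), with NO isotypic decomposition, no Peter–Weyl, no convolution algebra and no Fubini:

* `PhiFun μ π τ u x : V → H`, `w ↦ R(d·⟪τ · u, w⟫) x`, is linear (`PhiLM`), satisfies `PhiFun x u = R(f) x`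
  (`integratedForm_eq_PhiFun`) and INTERTWINES `τ` and `π` (`pi_PhiFun`: left invariance of `μ` + unitarity of `τ`);
  its kernel is `τ`-stable, so by Schur (p4's `IsIrreducible`) it is `0` or INJECTIVE (`PhiLM_eq_zero_or_injective`);
  its range is a finite-dimensional `π`-stable subspace (`isStable_range_PhiLM`, `finrank_range_PhiLM_le`):
  **`R(f) x` is the image of `u` under an equivariant map from `τ`, which is `0` or an embedded copy of `τ`**
  (`exists_copy`);
* **`R(f)` is idempotent** (`integratedForm_integratedForm`: `R(f)(R(f) x) = Phi x (∫ f g • τ g u) = Phi x u` by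
  p4's `integral_inner_smul_apply_self`), **`f* = f`** (`adjointFn_mc`), **`R(f)` is self-adjoint** (row 692's
  `isSelfAdjoint_integratedFormCLM` + `CompactUnimodular.isInvInvariant_of_compactSpace`), hence
  **`IsStarProjection (R f)`** (`isStarProjection_R`) and `R(f) = (range R(f)).starProjection`
  (`exists_eq_starProjection_range`): the orthogonal projection onto its range, on all of `H`
  (`integratedForm_apply_of_mem_range`, `integratedForm_apply_eq_zero_of_mem_orthogonal`);
* on every embedded copy of `τ` (an equivariant linear `ι : V →ₗ[ℂ] H`) `R(f)` acts as the rank-one projector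
  `ι v ↦ ⟪u, v⟫ • ι u` (`integratedForm_map_eq`, p4's projector transported), and on every equivariant
  `ι : W →L[ℂ] H` from a continuous irreducible unitary `σ ≇ τ` it is `0` (`integratedForm_map_eq_zero`).

Conventions: Mathlib's inner product is conjugate-linear in the first slot, so `⟪τ g u, u⟫` is the physicists'
`conj ⟨τ(g)u, u⟩` — the memo's `f_v` (as in p4's file); `π : G →* (H →ₗ[ℂ] H)` with
`T7SupportWeightTorusOrbital.IsUnitaryRep π` and `R(f) = integratedForm μ π f` are p1's row 692 vocabulary;
`τ : G →* (V →L[ℂ] V)` with `SchurProjector.IsUnitaryRep τ` / `IsIrreducible τ` is p4's. Nothing here is about an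
adelic group, a period or (N); the identification of `U(W_A)(F_{ι₁})` with `G`, of `L²([G])` with `H` and of the Haar
probability with `μ` is the dictionary (in words). No sorry; axioms ⊆ {propext, Classical.choice, Quot.sound}.
-/

namespace Summit.Ventures.HodgeRepro2.Tier7.Line3.OneVectorProjector

open MeasureTheory
open scoped InnerProductSpace
open Summit.Ventures.HodgeRepro2.T7SupportIntegratedForm (integratedForm integratedFormCLM integratedFormCLM_apply
  adjointFn IsStronglyMeasurable norm_apply integrable_smul isSelfAdjoint_integratedFormCLM)
open Summit.Ventures.HodgeRepro2.Tier7.Line3.SchurProjector (IsStable IsIrreducible IsEquivIso inner_apply_inv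
  integral_inner_smul_apply_self integral_inner_smul_apply_eq_zero)

variable {G : Type*} [Group G] [TopologicalSpace G] [IsTopologicalGroup G] [CompactSpace G]
  [MeasurableSpace G] [BorelSpace G] (μ : Measure G)
variable {V : Type*} [NormedAddCommGroup V] [InnerProductSpace ℂ V]
variable {H : Type*} [NormedAddCommGroup H] [InnerProductSpace ℂ H]

section Coefficient

/-- the one-vector coefficient function against `u`: `mc τ u w g = d · ⟪τ g u, w⟫`, `d = dim V`; the line's test
function is `mc τ u u`. -/
noncomputable def mc (τ : G →* (V →L[ℂ] V)) (u w : V) (g : G) : ℂ :=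
  (Module.finrank ℂ V : ℂ) * ⟪τ g u, w⟫_ℂ

omit [IsTopologicalGroup G] [CompactSpace G] [MeasurableSpace G] [BorelSpace G] in
/-- `mc τ u w` is continuous for continuous `τ`. -/
theorem continuous_mc {τ : G →* (V →L[ℂ] V)} (hτ : Continuous τ) (u w : V) : Continuous (mc τ u w) :=
  continuous_const.mul (continuous_inner.comp ((hτ.clm_apply continuous_const).prodMk continuous_const))

omit [IsTopologicalGroup G] in
/-- `mc τ u w` is integrable against a finite measure on the compact `G`. -/
theorem integrable_mc [IsFiniteMeasure μ] {τ : G →* (V →L[ℂ] V)} (hτ : Continuous τ) (u w : V) :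
    Integrable (mc τ u w) μ :=
  (continuous_mc hτ u w).integrable_of_hasCompactSupport (HasCompactSupport.of_compactSpace _)

omit [IsTopologicalGroup G] in
/-- the `V`-valued integrand `g ↦ mc τ u w g • τ g v` is integrable. -/
theorem integrable_mc_smul_apply [IsFiniteMeasure μ] {τ : G →* (V →L[ℂ] V)} (hτ : Continuous τ) (u w v : V) :
    Integrable (fun g => mc τ u w g • τ g v) μ :=
  ((continuous_mc hτ u w).smul (hτ.clm_apply continuous_const)).integrable_of_hasCompactSupport
    (HasCompactSupport.of_compactSpace _)

omit [TopologicalSpace G] [IsTopologicalGroup G] [CompactSpace G] [MeasurableSpace G] [BorelSpace G] in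
/-- **`f* = f` for the line's test function**: `adjointFn (mc τ u u) = mc τ u u` (unitarity of `τ`). -/
theorem adjointFn_mc {τ : G →* (V →L[ℂ] V)} (hτu : SchurProjector.IsUnitaryRep τ) (u : V) :
    adjointFn (mc τ u u) = mc τ u u := by
  funext g
  unfold adjointFn mc
  rw [map_mul, map_natCast, inner_conj_symm, inner_apply_inv τ hτu g u u]

omit [IsTopologicalGroup G] in
/-- strong continuity of `π` gives row 692's strong measurability. -/
theorem isStronglyMeasurable_of_continuous {π : G →* (H →ₗ[ℂ] H)} (hc : ∀ x, Continuous fun g => π g x) :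
    IsStronglyMeasurable μ π := fun x =>
  ((hc x).stronglyMeasurable_of_hasCompactSupport (HasCompactSupport.of_compactSpace _)).aestronglyMeasurable

omit [IsTopologicalGroup G] in
/-- the `H`-valued integrand `g ↦ mc τ u w g • π g x` is integrable. -/
theorem integrable_mc_smul [IsFiniteMeasure μ] {τ : G →* (V →L[ℂ] V)} (hτ : Continuous τ)
    {π : G →* (H →ₗ[ℂ] H)} (hπ : T7SupportWeightTorusOrbital.IsUnitaryRep π)
    (hc : ∀ x, Continuous fun g => π g x) (u w : V) (x : H) :
    Integrable (fun g => mc τ u w g • π g x) μ :=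
  integrable_smul μ hπ (isStronglyMeasurable_of_continuous μ hc) (integrable_mc μ hτ u w) x

end Coefficient

section Phi

variable [CompleteSpace H]

/-- `PhiFun μ π τ u x w := R(mc τ u w) x = ∫ (d · ⟪τ g u, w⟫) • π g x dμ` — the map `w ↦ R(d·⟪τ · u, w⟫) x`. -/
noncomputable def PhiFun (π : G →* (H →ₗ[ℂ] H)) (τ : G →* (V →L[ℂ] V)) (u : V) (x : H) (w : V) : H :=
  integratedForm μ π (mc τ u w) x

omit [TopologicalSpace G] [IsTopologicalGroup G] [CompactSpace G] [BorelSpace G] [CompleteSpace H] in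
/-- **`R(f) x = PhiFun x u`** for the line's `f = mc τ u u`. -/
theorem integratedForm_eq_PhiFun (π : G →* (H →ₗ[ℂ] H)) (τ : G →* (V →L[ℂ] V)) (u : V) (x : H) :
    integratedForm μ π (mc τ u u) x = PhiFun μ π τ u x u := rfl

omit [IsTopologicalGroup G] [CompleteSpace H] in
/-- `PhiFun x` is additive in `w`. -/
theorem PhiFun_add [IsFiniteMeasure μ] {τ : G →* (V →L[ℂ] V)} (hτ : Continuous τ) {π : G →* (H →ₗ[ℂ] H)}
    (hπ : T7SupportWeightTorusOrbital.IsUnitaryRep π) (hc : ∀ x, Continuous fun g => π g x) (u : V) (x : H)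
    (w₁ w₂ : V) : PhiFun μ π τ u x (w₁ + w₂) = PhiFun μ π τ u x w₁ + PhiFun μ π τ u x w₂ := by
  unfold PhiFun integratedForm
  have e : ∀ g, mc τ u (w₁ + w₂) g • π g x = mc τ u w₁ g • π g x + mc τ u w₂ g • π g x := by
    intro g
    simp only [mc, inner_add_right, mul_add, add_smul]
  simp_rw [e]
  exact integral_add (integrable_mc_smul μ hτ hπ hc u w₁ x) (integrable_mc_smul μ hτ hπ hc u w₂ x)

omit [TopologicalSpace G] [IsTopologicalGroup G] [CompactSpace G] [BorelSpace G] [CompleteSpace H] in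
/-- `PhiFun x` is `ℂ`-homogeneous in `w`. -/
theorem PhiFun_smul (π : G →* (H →ₗ[ℂ] H)) (τ : G →* (V →L[ℂ] V)) (u : V) (x : H) (c : ℂ) (w : V) :
    PhiFun μ π τ u x (c • w) = c • PhiFun μ π τ u x w := by
  unfold PhiFun integratedForm
  have e : ∀ g, mc τ u (c • w) g • π g x = c • (mc τ u w g • π g x) := by
    intro g
    simp only [mc]
    rw [inner_smul_right, mul_left_comm, mul_smul]
  simp_rw [e]
  exact integral_smul c _

/-- `PhiFun x` as a linear map `V →ₗ[ℂ] H`. -/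
noncomputable def PhiLM [IsFiniteMeasure μ] {τ : G →* (V →L[ℂ] V)} (hτ : Continuous τ) {π : G →* (H →ₗ[ℂ] H)}
    (hπ : T7SupportWeightTorusOrbital.IsUnitaryRep π) (hc : ∀ x, Continuous fun g => π g x) (u : V) (x : H) :
    V →ₗ[ℂ] H where
  toFun := PhiFun μ π τ u x
  map_add' := PhiFun_add μ hτ hπ hc u x
  map_smul' := PhiFun_smul μ π τ u x

omit [IsTopologicalGroup G] [CompleteSpace H] in
/-- `PhiLM x w = PhiFun x w`. -/
theorem PhiLM_apply [IsFiniteMeasure μ] {τ : G →* (V →L[ℂ] V)} (hτ : Continuous τ) {π : G →* (H →ₗ[ℂ] H)}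
    (hπ : T7SupportWeightTorusOrbital.IsUnitaryRep π) (hc : ∀ x, Continuous fun g => π g x) (u : V) (x : H)
    (w : V) : PhiLM μ hτ hπ hc u x w = PhiFun μ π τ u x w := rfl

omit [TopologicalSpace G] [IsTopologicalGroup G] [CompactSpace G] [MeasurableSpace G] [BorelSpace G] in
/-- `π k` as a bounded operator (unitary, norm `1`-Lipschitz). -/
noncomputable def piCLM (π : G →* (H →ₗ[ℂ] H)) (hπ : T7SupportWeightTorusOrbital.IsUnitaryRep π) (k : G) :
    H →L[ℂ] H :=
  LinearMap.mkContinuous (π k) 1 (fun y => by rw [norm_apply hπ, one_mul])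

omit [TopologicalSpace G] [IsTopologicalGroup G] [CompactSpace G] [MeasurableSpace G] [BorelSpace G]
  [CompleteSpace H] in
/-- `piCLM π hπ k y = π k y`. -/
theorem piCLM_apply (π : G →* (H →ₗ[ℂ] H)) (hπ : T7SupportWeightTorusOrbital.IsUnitaryRep π) (k : G) (y : H) :
    piCLM π hπ k y = π k y := rfl

/-- **`PhiFun x` intertwines `τ` and `π`**: `π k (PhiFun x w) = PhiFun x (τ k w)` (left invariance of `μ` and
unitarity of `τ`). -/
theorem pi_PhiFun [IsFiniteMeasure μ] [μ.IsMulLeftInvariant] {τ : G →* (V →L[ℂ] V)} (hτ : Continuous τ)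
    (hτu : SchurProjector.IsUnitaryRep τ) {π : G →* (H →ₗ[ℂ] H)} (hπ : T7SupportWeightTorusOrbital.IsUnitaryRep π)
    (hc : ∀ x, Continuous fun g => π g x) (u : V) (x : H) (k : G) (w : V) :
    π k (PhiFun μ π τ u x w) = PhiFun μ π τ u x (τ k w) := by
  unfold PhiFun integratedForm
  rw [← piCLM_apply π hπ k, ← ContinuousLinearMap.integral_comp_comm _ (integrable_mc_smul μ hτ hπ hc u w x)]
  have e : ∀ g, piCLM π hπ k (mc τ u w g • π g x) = (fun g => mc τ u (τ k w) g • π g x) (k * g) := by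
    intro g
    simp only [map_smul, piCLM_apply, mc]
    rw [map_mul π, Module.End.mul_apply, map_mul τ, ContinuousLinearMap.mul_def, ContinuousLinearMap.comp_apply, hτu k]
  simp_rw [e]
  exact integral_mul_left_eq_self (fun g => mc τ u (τ k w) g • π g x) k

/-- the kernel of `PhiLM x` is `τ`-stable. -/
theorem isStable_ker_PhiLM [IsFiniteMeasure μ] [μ.IsMulLeftInvariant] {τ : G →* (V →L[ℂ] V)} (hτ : Continuous τ)
    (hτu : SchurProjector.IsUnitaryRep τ) {π : G →* (H →ₗ[ℂ] H)} (hπ : T7SupportWeightTorusOrbital.IsUnitaryRep π)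
    (hc : ∀ x, Continuous fun g => π g x) (u : V) (x : H) :
    IsStable τ (LinearMap.ker (PhiLM μ hτ hπ hc u x)) := by
  intro k w hw
  rw [LinearMap.mem_ker] at hw ⊢
  rw [PhiLM_apply, ← pi_PhiFun μ hτ hτu hπ hc u x k w, ← PhiLM_apply μ hτ hπ hc, hw, map_zero]

/-- **Schur**: `PhiLM x` is `0` or injective (its kernel is a stable subspace of the irreducible `τ`). -/
theorem PhiLM_eq_zero_or_injective [IsFiniteMeasure μ] [μ.IsMulLeftInvariant] {τ : G →* (V →L[ℂ] V)}
    (hτ : Continuous τ) (hτu : SchurProjector.IsUnitaryRep τ) (hτi : IsIrreducible τ) {π : G →* (H →ₗ[ℂ] H)}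
    (hπ : T7SupportWeightTorusOrbital.IsUnitaryRep π) (hc : ∀ x, Continuous fun g => π g x) (u : V) (x : H) :
    PhiLM μ hτ hπ hc u x = 0 ∨ Function.Injective (PhiLM μ hτ hπ hc u x) := by
  rcases hτi.eq_bot_or_eq_top _ (isStable_ker_PhiLM μ hτ hτu hπ hc u x) with h | h
  · exact Or.inr (LinearMap.ker_eq_bot.1 h)
  · left
    ext w
    have hw : w ∈ LinearMap.ker (PhiLM μ hτ hπ hc u x) := by
      rw [h]
      exact Submodule.mem_top
    exact LinearMap.mem_ker.1 hw

/-- the range of `PhiLM x` is `π`-stable. -/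
theorem isStable_range_PhiLM [IsFiniteMeasure μ] [μ.IsMulLeftInvariant] {τ : G →* (V →L[ℂ] V)} (hτ : Continuous τ)
    (hτu : SchurProjector.IsUnitaryRep τ) {π : G →* (H →ₗ[ℂ] H)} (hπ : T7SupportWeightTorusOrbital.IsUnitaryRep π)
    (hc : ∀ x, Continuous fun g => π g x) (u : V) (x : H) (k : G) :
    ∀ y ∈ LinearMap.range (PhiLM μ hτ hπ hc u x), π k y ∈ LinearMap.range (PhiLM μ hτ hπ hc u x) := by
  intro y hy
  obtain ⟨w, rfl⟩ := LinearMap.mem_range.1 hy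
  exact ⟨τ k w, (pi_PhiFun μ hτ hτu hπ hc u x k w).symm⟩

omit [IsTopologicalGroup G] [CompleteSpace H] in
/-- the range of `PhiLM x` has dimension at most `dim V`. -/
theorem finrank_range_PhiLM_le [IsFiniteMeasure μ] [FiniteDimensional ℂ V] {τ : G →* (V →L[ℂ] V)}
    (hτ : Continuous τ) {π : G →* (H →ₗ[ℂ] H)} (hπ : T7SupportWeightTorusOrbital.IsUnitaryRep π)
    (hc : ∀ x, Continuous fun g => π g x) (u : V) (x : H) :
    Module.finrank ℂ (LinearMap.range (PhiLM μ hτ hπ hc u x)) ≤ Module.finrank ℂ V :=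
  LinearMap.finrank_range_le _

/-- **`R(f) x` lies in an embedded copy of `τ`**: either `R(f) x = 0`, or the (finite-dimensional, `π`-stable)
range of `PhiLM x` is a copy of `τ` — an equivariant linear equivalence `e : V ≃ₗ[ℂ] range (PhiLM x)` — and
`R(f) x = e u`: the image of `u` in that copy. -/
theorem exists_copy [IsFiniteMeasure μ] [μ.IsMulLeftInvariant] {τ : G →* (V →L[ℂ] V)} (hτ : Continuous τ)
    (hτu : SchurProjector.IsUnitaryRep τ) (hτi : IsIrreducible τ) {π : G →* (H →ₗ[ℂ] H)}
    (hπ : T7SupportWeightTorusOrbital.IsUnitaryRep π) (hc : ∀ x, Continuous fun g => π g x) (u : V) (x : H) :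
    integratedForm μ π (mc τ u u) x = 0 ∨
      ∃ e : V ≃ₗ[ℂ] LinearMap.range (PhiLM μ hτ hπ hc u x),
        (∀ k w, (e (τ k w) : H) = π k (e w)) ∧ (e u : H) = integratedForm μ π (mc τ u u) x := by
  rcases PhiLM_eq_zero_or_injective μ hτ hτu hτi hπ hc u x with h | h
  · left
    rw [integratedForm_eq_PhiFun, ← PhiLM_apply μ hτ hπ hc, h, LinearMap.zero_apply]
  · right
    refine ⟨LinearEquiv.ofInjective _ h, fun k w => ?_, ?_⟩
    · simp only [LinearEquiv.ofInjective_apply, PhiLM_apply]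
      exact (pi_PhiFun μ hτ hτu hπ hc u x k w).symm
    · simp only [LinearEquiv.ofInjective_apply, PhiLM_apply]
      rfl

end Phi

section Projector

variable [CompleteSpace H] [FiniteDimensional ℂ V] [CompleteSpace V]

/-- the line's `R(f)` as a bounded operator on `H`, `f = mc τ u u` (row 692's `integratedFormCLM`). -/
noncomputable def Rop [IsFiniteMeasure μ] {τ : G →* (V →L[ℂ] V)} (hτ : Continuous τ) {π : G →* (H →ₗ[ℂ] H)}
    (hπ : T7SupportWeightTorusOrbital.IsUnitaryRep π) (hc : ∀ x, Continuous fun g => π g x) (u : V) : H →L[ℂ] H :=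
  integratedFormCLM μ hπ (isStronglyMeasurable_of_continuous μ hc) (integrable_mc μ hτ u u)

omit [IsTopologicalGroup G] [CompleteSpace H] [FiniteDimensional ℂ V] [CompleteSpace V] in
/-- `Rop x = R(f) x = ∫ (d · ⟪τ g u, u⟫) • π g x dμ`. -/
theorem Rop_apply [IsFiniteMeasure μ] {τ : G →* (V →L[ℂ] V)} (hτ : Continuous τ) {π : G →* (H →ₗ[ℂ] H)}
    (hπ : T7SupportWeightTorusOrbital.IsUnitaryRep π) (hc : ∀ x, Continuous fun g => π g x) (u : V) (x : H) :
    Rop μ hτ hπ hc u x = integratedForm μ π (mc τ u u) x := rfl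

/-- the `V`-valued integral of the line's test function against `τ` is the rank-one projector of p4's
`SchurProjector.integral_inner_smul_apply_self`: `∫ mc τ u u g • τ g v dμ = ⟪u, v⟫ • u`. -/
theorem integral_mc_smul_apply_eq [IsProbabilityMeasure μ] [μ.IsMulLeftInvariant] {τ : G →* (V →L[ℂ] V)}
    (hτ : Continuous τ) (hτu : SchurProjector.IsUnitaryRep τ) (hτi : IsIrreducible τ) (u v : V) :
    ∫ g, mc τ u u g • τ g v ∂μ = ⟪u, v⟫_ℂ • u := by
  rw [← integral_inner_smul_apply_self μ τ hτ hτu hτi u v, ← integral_smul]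
  congr 1
  funext g
  simp only [mc, mul_smul]

/-- **`R(f)` is idempotent** (`‖u‖ = 1`, i.e. `⟪u, u⟫ = 1`): `R(f) (R(f) x) = R(f) x` — through `PhiLM x`, which
commutes with the integral and intertwines, and p4's projector formula; no convolution, no Fubini. -/
theorem integratedForm_integratedForm [IsProbabilityMeasure μ] [μ.IsMulLeftInvariant] {τ : G →* (V →L[ℂ] V)}
    (hτ : Continuous τ) (hτu : SchurProjector.IsUnitaryRep τ) (hτi : IsIrreducible τ) {π : G →* (H →ₗ[ℂ] H)}
    (hπ : T7SupportWeightTorusOrbital.IsUnitaryRep π) (hc : ∀ x, Continuous fun g => π g x) (u : V)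
    (hu : ⟪u, u⟫_ℂ = 1) (x : H) :
    integratedForm μ π (mc τ u u) (integratedForm μ π (mc τ u u) x) = integratedForm μ π (mc τ u u) x := by
  rw [integratedForm_eq_PhiFun μ π τ u x]
  show (∫ g, mc τ u u g • π g (PhiFun μ π τ u x u) ∂μ) = PhiFun μ π τ u x u
  have e : ∀ g, mc τ u u g • π g (PhiFun μ π τ u x u) =
      LinearMap.toContinuousLinearMap (PhiLM μ hτ hπ hc u x) (mc τ u u g • τ g u) := by
    intro g
    rw [map_smul, LinearMap.coe_toContinuousLinearMap', PhiLM_apply, pi_PhiFun μ hτ hτu hπ hc u x g u]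
  simp_rw [e]
  rw [ContinuousLinearMap.integral_comp_comm _ (integrable_mc_smul_apply μ hτ u u u),
    integral_mc_smul_apply_eq μ hτ hτu hτi u u, hu, one_smul, LinearMap.coe_toContinuousLinearMap', PhiLM_apply]

/-- **`R(f)` is idempotent** as a bounded operator. -/
theorem isIdempotentElem_Rop [IsProbabilityMeasure μ] [μ.IsMulLeftInvariant] {τ : G →* (V →L[ℂ] V)}
    (hτ : Continuous τ) (hτu : SchurProjector.IsUnitaryRep τ) (hτi : IsIrreducible τ) {π : G →* (H →ₗ[ℂ] H)}
    (hπ : T7SupportWeightTorusOrbital.IsUnitaryRep π) (hc : ∀ x, Continuous fun g => π g x) (u : V)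
    (hu : ⟪u, u⟫_ℂ = 1) : IsIdempotentElem (Rop μ hτ hπ hc u) := by
  refine ContinuousLinearMap.ext fun x => ?_
  exact integratedForm_integratedForm μ hτ hτu hτi hπ hc u hu x

omit [FiniteDimensional ℂ V] [CompleteSpace V] in
/-- **`R(f)` is self-adjoint**: `f* = f` and, `G` being compact, the Haar probability `μ` is inversion-invariant
(`CompactUnimodular.isInvInvariant_of_compactSpace`), so row 692's `isSelfAdjoint_integratedFormCLM` applies. -/
theorem isSelfAdjoint_Rop [μ.IsHaarMeasure] [IsProbabilityMeasure μ] {τ : G →* (V →L[ℂ] V)} (hτ : Continuous τ)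
    (hτu : SchurProjector.IsUnitaryRep τ) {π : G →* (H →ₗ[ℂ] H)} (hπ : T7SupportWeightTorusOrbital.IsUnitaryRep π)
    (hc : ∀ x, Continuous fun g => π g x) (u : V) : IsSelfAdjoint (Rop μ hτ hπ hc u) := by
  haveI := CompactUnimodular.isInvInvariant_of_compactSpace μ
  exact isSelfAdjoint_integratedFormCLM μ hπ _ _ (adjointFn_mc hτu u)

/-- **`R(f)` is a star projection** (idempotent and self-adjoint) on the whole of `H`. -/
theorem isStarProjection_Rop [μ.IsHaarMeasure] [IsProbabilityMeasure μ] {τ : G →* (V →L[ℂ] V)} (hτ : Continuous τ)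
    (hτu : SchurProjector.IsUnitaryRep τ) (hτi : IsIrreducible τ) {π : G →* (H →ₗ[ℂ] H)}
    (hπ : T7SupportWeightTorusOrbital.IsUnitaryRep π) (hc : ∀ x, Continuous fun g => π g x) (u : V)
    (hu : ⟪u, u⟫_ℂ = 1) : IsStarProjection (Rop μ hτ hπ hc u) :=
  ⟨isIdempotentElem_Rop μ hτ hτu hτi hπ hc u hu, isSelfAdjoint_Rop μ hτ hτu hπ hc u⟩

/-- **`R(f)` is the orthogonal projection onto its range** (Mathlib's `starProjection`). -/
theorem exists_eq_starProjection_range [μ.IsHaarMeasure] [IsProbabilityMeasure μ] {τ : G →* (V →L[ℂ] V)}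
    (hτ : Continuous τ) (hτu : SchurProjector.IsUnitaryRep τ) (hτi : IsIrreducible τ) {π : G →* (H →ₗ[ℂ] H)}
    (hπ : T7SupportWeightTorusOrbital.IsUnitaryRep π) (hc : ∀ x, Continuous fun g => π g x) (u : V)
    (hu : ⟪u, u⟫_ℂ = 1) :
    ∃ (_ : (Rop μ hτ hπ hc u).range.HasOrthogonalProjection),
      Rop μ hτ hπ hc u = (Rop μ hτ hπ hc u).range.starProjection :=
  isStarProjection_iff_eq_starProjection_range.1 (isStarProjection_Rop μ hτ hτu hτi hπ hc u hu)

/-- `R(f)` fixes every vector of its range. -/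
theorem Rop_apply_of_mem_range [IsProbabilityMeasure μ] [μ.IsMulLeftInvariant] {τ : G →* (V →L[ℂ] V)}
    (hτ : Continuous τ) (hτu : SchurProjector.IsUnitaryRep τ) (hτi : IsIrreducible τ) {π : G →* (H →ₗ[ℂ] H)}
    (hπ : T7SupportWeightTorusOrbital.IsUnitaryRep π) (hc : ∀ x, Continuous fun g => π g x) (u : V)
    (hu : ⟪u, u⟫_ℂ = 1) {y : H} (hy : y ∈ (Rop μ hτ hπ hc u).range) : Rop μ hτ hπ hc u y = y := by
  obtain ⟨x, rfl⟩ := LinearMap.mem_range.1 hy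
  exact congrArg (fun T : H →L[ℂ] H => T x) (isIdempotentElem_Rop μ hτ hτu hτi hπ hc u hu)

/-- `R(f)` kills the orthogonal complement of its range. -/
theorem Rop_apply_eq_zero_of_mem_orthogonal [μ.IsHaarMeasure] [IsProbabilityMeasure μ] {τ : G →* (V →L[ℂ] V)}
    (hτ : Continuous τ) (hτu : SchurProjector.IsUnitaryRep τ) (hτi : IsIrreducible τ) {π : G →* (H →ₗ[ℂ] H)}
    (hπ : T7SupportWeightTorusOrbital.IsUnitaryRep π) (hc : ∀ x, Continuous fun g => π g x) (u : V)
    (hu : ⟪u, u⟫_ℂ = 1) {x : H} (hx : x ∈ (Rop μ hτ hπ hc u).rangeᗮ) : Rop μ hτ hπ hc u x = 0 := by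
  have hsym := (isSelfAdjoint_Rop μ hτ hτu hπ hc u).isSymmetric
  rw [← inner_self_eq_zero (𝕜 := ℂ)]
  have h1 : ⟪Rop μ hτ hπ hc u x, Rop μ hτ hπ hc u x⟫_ℂ = ⟪x, Rop μ hτ hπ hc u (Rop μ hτ hπ hc u x)⟫_ℂ :=
    hsym x (Rop μ hτ hπ hc u x)
  have h2 : Rop μ hτ hπ hc u (Rop μ hτ hπ hc u x) = Rop μ hτ hπ hc u x :=
    congrArg (fun T : H →L[ℂ] H => T x) (isIdempotentElem_Rop μ hτ hτu hτi hπ hc u hu)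
  rw [h1, h2]
  exact Submodule.inner_left_of_mem_orthogonal (LinearMap.mem_range_self _ x) hx

/-- **on every embedded copy of `τ`** (an equivariant linear `ι : V →ₗ[ℂ] H`) **`R(f)` is the rank-one projector
onto the `u`-line**: `R(f) (ι v) = ⟪u, v⟫ • ι u` (p4's projector transported along `ι`). -/
theorem integratedForm_map_eq [IsProbabilityMeasure μ] [μ.IsMulLeftInvariant] {τ : G →* (V →L[ℂ] V)}
    (hτ : Continuous τ) (hτu : SchurProjector.IsUnitaryRep τ) (hτi : IsIrreducible τ) {π : G →* (H →ₗ[ℂ] H)}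
    (u : V) (ι : V →ₗ[ℂ] H) (hι : ∀ g v, ι (τ g v) = π g (ι v)) (v : V) :
    integratedForm μ π (mc τ u u) (ι v) = ⟪u, v⟫_ℂ • ι u := by
  unfold integratedForm
  have e : ∀ g, mc τ u u g • π g (ι v) = LinearMap.toContinuousLinearMap ι (mc τ u u g • τ g v) := by
    intro g
    rw [map_smul, LinearMap.coe_toContinuousLinearMap', hι]
  simp_rw [e]
  rw [ContinuousLinearMap.integral_comp_comm _ (integrable_mc_smul_apply μ hτ u u v),
    integral_mc_smul_apply_eq μ hτ hτu hτi u v, LinearMap.coe_toContinuousLinearMap', map_smul]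

omit [FiniteDimensional ℂ V] [CompleteSpace V] in
/-- **on every embedded copy of an irreducible `σ ≇ τ`** (an equivariant `ι : W →L[ℂ] H`) **`R(f)` vanishes**:
`R(f) (ι w) = 0` (p4's `integral_inner_smul_apply_eq_zero` transported along `ι`). -/
theorem integratedForm_map_eq_zero {W : Type*} [NormedAddCommGroup W] [InnerProductSpace ℂ W] [CompleteSpace W]
    [IsFiniteMeasure μ] [μ.IsMulLeftInvariant] {τ : G →* (V →L[ℂ] V)} (hτ : Continuous τ)
    (hτu : SchurProjector.IsUnitaryRep τ) (hτi : IsIrreducible τ) (σ : G →* (W →L[ℂ] W)) (hσ : Continuous σ)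
    (hσi : IsIrreducible σ) (hne : ¬ IsEquivIso σ τ) {π : G →* (H →ₗ[ℂ] H)} (u : V) (ι : W →L[ℂ] H)
    (hι : ∀ g w, ι (σ g w) = π g (ι w)) (w : W) : integratedForm μ π (mc τ u u) (ι w) = 0 := by
  unfold integratedForm
  have e : ∀ g, mc τ u u g • π g (ι w) = ι (mc τ u u g • σ g w) := by
    intro g
    rw [map_smul, hι]
  simp_rw [e]
  have hint : Integrable (fun g => mc τ u u g • σ g w) μ :=
    ((continuous_mc hτ u u).smul (hσ.clm_apply continuous_const)).integrable_of_hasCompactSupport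
      (HasCompactSupport.of_compactSpace _)
  rw [ContinuousLinearMap.integral_comp_comm _ hint]
  have h2 : ∫ g, mc τ u u g • σ g w ∂μ = 0 := by
    have h0 := integral_inner_smul_apply_eq_zero μ σ τ hσ hτ hτu hσi hτi hne u w u
    rw [← smul_zero (Module.finrank ℂ V : ℂ), ← h0, ← integral_smul]
    congr 1
    funext g
    simp only [mc, mul_smul]
  rw [h2, map_zero]

end Projector

end Summit.Ventures.HodgeRepro2.Tier7.Line3.OneVectorProjector
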